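import Summits.NavierStokesRegularity.NavierStokesRegularity.Theorems.TerminalTraceTypeITraceScarL3DepthShellMass
import Literature.Analysis.FluidPDE.TaoMainEstimateVorticityAnnulus
import Literature.Analysis.FluidPDE.ClassicalSuitableRegion
import HarnessLib

/-!
# Depth vorticity rigidity, part 11 — Tao's (5.8)–(5.17) on a quiet shell: a POSITIVE, `b`-INDEPENDENT lower
# bound for the vorticity of an extinct Type-I apex on an annulus at every late time `b` (Q4 of
# ROUND-26) — helper for item `TerminalTrace.TypeITraceScarL3` (stmt-NavierStokesRegularity-18385),
# stub `stub_quietShell_noConcentration` of line `annulus-dichotomy` v4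

Seat nsreg-C26-p1 (prover), `--supports stmt-NavierStokesRegularity-18385`; planner of record nsreg-p2
g28, ROUND-26 §1c (Q4) «THE SQUEEZE (Tao (5.8)–(5.17))».

* `exists_annulus_vorticity_floor` — CLASS constants `Λc`: for `(U, P)` in Albritton–Barker's class
  with `D ≤ D₀`, rate `C/√(−s)`, its classical representative `v` (continuous, jointly smooth,
  classical on every `[b − T, b]`, `b < 0`) having the centre concentration (Q1) with constants
  `(κ₀, c₂)`, every `Λ ≥ Λc`, `R' > 0`, and bounds `‖v‖, ‖D v‖, ‖ω‖, ‖D ω‖ ≤ K₃` on a late shell slab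
  `]−δ₃, 0[ × {R₁ < |x| < R₂}` containing `[R', ΛR']` and `]100R', 400R'[`: there are `η > 0` and
  `b₀ < 0` such that `∫_{2R' ≤ |x| ≤ ΛR'/2} |ω(b, x)|² dx ≥ η` for EVERY `b ∈ ]b₀, 0[`.
  Proof: the tree's `IsClassicalNSSolutionOn.vorticity_annulus_lower_bound` (Tao (5.8)–(5.17), first
  and second Carleman inequalities) on `[b − T, b]` with `T` so small that the shell bounds are the
  normalised (5.10); its depth-shell hypothesis (5.7) is `exists_depth_ball_mass` integrated in time
  (the enstrophy `t ↦ ∫ |ω(t)|²` over the shell is continuous by dominated convergence); `Λc` beats the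
  Gaussian loss of (5.7).

WHAT THIS IS NOT: not the stub (the contradiction with the zero top data is the next file), not item
18385, no statement about Navier–Stokes regularity.  [cite: Tao2021, §5 (5.7)–(5.17)]
-/

noncomputable section

set_option linter.dupNamespace false

namespace Summit.NavierStokesRegularity.NavierStokesRegularity.Theorems.TypeITraceScarL3

open MeasureTheory Set Function Filter Topology TopologicalSpace Metric InnerProductSpace
open Literature.Analysis Literature.Analysis.FluidPDE
open scoped NNReal ENNReal RealInnerProductSpace

/-- Continuity in time of the enstrophy `t ↦ ∫_S |ω(t,x)|² dx` of a jointly continuous vorticity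
over a set `S` of finite volume on which it is bounded (dominated convergence). -/
theorem continuousOn_setIntegral_vorticity_sq
    {v : ℝ → EuclideanSpace ℝ (Fin 3) → EuclideanSpace ℝ (Fin 3)} {J : Set ℝ}
    (hωc : ContinuousOn (fun z : ℝ × EuclideanSpace ℝ (Fin 3) => vorticity v z.1 z.2)
      (J ×ˢ (univ : Set (EuclideanSpace ℝ (Fin 3)))))
    {S : Set (EuclideanSpace ℝ (Fin 3))} (hSm : MeasurableSet S) (hSvol : volume S ≠ ⊤) {B : ℝ}
    (hB : ∀ t ∈ J, ∀ x ∈ S, ‖vorticity v t x‖ ≤ B) :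
    ContinuousOn (fun t => ∫ x in S, ‖vorticity v t x‖ ^ 2) J := by
  have hsl : ∀ t ∈ J, Continuous (vorticity v t) := by
    intro t ht
    have h : ContinuousOn (fun x : EuclideanSpace ℝ (Fin 3) => vorticity v t x) univ :=
      hωc.comp (f := fun x : EuclideanSpace ℝ (Fin 3) => ((t, x) : ℝ × EuclideanSpace ℝ (Fin 3)))
        (continuousOn_const.prodMk continuousOn_id) fun x _ => ⟨ht, mem_univ _⟩
    exact continuousOn_univ.1 h
  refine continuousOn_of_dominated (μ := volume.restrict S) (bound := fun _ => B ^ 2) ?_ ?_ ?_ ?_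
  · intro t ht
    exact (((hsl t ht).norm.pow 2).aestronglyMeasurable)
  · intro t ht
    refine (ae_restrict_iff' hSm).2 (ae_of_all _ fun x hx => ?_)
    rw [Real.norm_eq_abs, abs_of_nonneg (by positivity)]
    exact pow_le_pow_left₀ (norm_nonneg _) (hB t ht x hx) 2
  · exact integrableOn_const hSvol
  · refine (ae_restrict_iff' hSm).2 (ae_of_all _ fun x _ => ?_)
    have h1 : ContinuousOn (fun t : ℝ => vorticity v t x) J :=
      hωc.comp (f := fun t : ℝ => ((t, x) : ℝ × EuclideanSpace ℝ (Fin 3)))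
        (continuousOn_id.prodMk continuousOn_const) fun t ht => ⟨ht, mem_univ _⟩
    exact h1.norm.pow 2

/-- **Annulus vorticity floor at every late time (Tao (5.8)–(5.17) on a quiet shell).**  See the module
docstring. [cite: Tao2021, §5 (5.7)–(5.17)] -/
theorem exists_annulus_vorticity_floor (C : ℝ) (D₀ : ℝ≥0) {κ₀ c₂ : ℝ} (hκ₀ : 0 < κ₀) (hc₂ : 0 < c₂)
    (hc₂' : c₂ < 1 / 2) :
    ∃ Λc : ℝ, 400 ≤ Λc ∧
    ∀ (U : ℝ → EuclideanSpace ℝ (Fin 3) → EuclideanSpace ℝ (Fin 3))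
      (P : ℝ → EuclideanSpace ℝ (Fin 3) → ℝ)
      (v : ℝ → EuclideanSpace ℝ (Fin 3) → EuclideanSpace ℝ (Fin 3)),
      (∀ a : ℝ, 0 < a →
        IsSuitableWeakSolutionInBall a (0 : ℝ × EuclideanSpace ℝ (Fin 3)) U P) →
      (∀ z₀ : ℝ × EuclideanSpace ℝ (Fin 3), z₀.1 ≤ 0 →
        ∀ r : ℝ, 0 < r → cknD r z₀ P ≤ D₀) →
      (∀ s : ℝ, s < 0 →
        ∀ᵐ y : EuclideanSpace ℝ (Fin 3), ‖U s y‖ ≤ C / Real.sqrt (-s)) →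
      (∀ᵐ w ∂(volume.restrict (Iio (0 : ℝ) ×ˢ (univ : Set (EuclideanSpace ℝ (Fin 3))))),
        uncurry U w = uncurry v w) →
      ContinuousOn (uncurry v) (Iio 0 ×ˢ univ) →
      IsSmoothSpaceTimeOn (Iio 0) v →
      (∀ b T : ℝ, b < 0 → 0 < T →
        ∃ q : ℝ → EuclideanSpace ℝ (Fin 3) → ℝ, IsClassicalNSSolutionOn (Icc (b - T) b) 1 0 v q) →
      (∀ T₁ : ℝ, 0 < T₁ → ∃ t₁ ∈ Icc (-T₁) (-T₁ / 2), ∀ t ∈ Icc (t₁ - c₂ * T₁) t₁,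
        κ₀ * T₁ ^ (-(1 / 2 : ℝ)) ≤
          ∫ x in ball (0 : EuclideanSpace ℝ (Fin 3)) (Real.sqrt T₁), ‖curl (v t) x‖ ^ 2) →
      ∀ (Λ R' δ₃ R₁ R₂ K₃ : ℝ), Λc ≤ Λ → 0 < R' → 0 < δ₃ → 1 ≤ K₃ →
        R₁ < R' → Λ * R' < R₂ →
        (∀ t ∈ Ioo (-δ₃) 0, ∀ x : EuclideanSpace ℝ (Fin 3), R₁ < ‖x‖ → ‖x‖ < R₂ →
          ‖v t x‖ ≤ K₃ ∧ ‖fderiv ℝ (v t) x‖ ≤ K₃ ∧ ‖vorticity v t x‖ ≤ K₃ ∧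
            ‖fderiv ℝ (vorticity v t) x‖ ≤ K₃) →
        ∃ η b₀ : ℝ, 0 < η ∧ b₀ < 0 ∧ ∀ b ∈ Ioo b₀ 0,
          η ≤ ∫ x in closedBall (0 : EuclideanSpace ℝ (Fin 3)) (Λ * R' / 2) \ ball 0 (2 * R'),
            ‖vorticity v b x‖ ^ 2 := by
  -- ### class constants
  obtain ⟨Γ, hΓ0, hball⟩ := exists_depth_ball_mass C D₀ hκ₀ hc₂ hc₂'
  obtain ⟨Λ₀, Kt, hΛ₀, hKt, htao⟩ := IsClassicalNSSolutionOn.vorticity_annulus_lower_bound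
  set γ₀ : ℝ := c₂ * κ₀ / 2 / Real.sqrt (8 * 10 ^ 12) with hγ₀
  have hγ₀0 : 0 < γ₀ := by positivity
  set L₀ : ℝ := max 0 (-Real.log γ₀) with hL₀
  have hL₀0 : 0 ≤ L₀ := le_max_left _ _
  set Λc : ℝ := max Λ₀ (max 400 (8 * (8 * 10 ^ 12 * Γ + L₀ + 1))) with hΛc
  refine ⟨Λc, (le_max_left _ _).trans (le_max_right _ _), ?_⟩
  intro U P v hsw hD hrate hvU hvc hvs hcl hQ1 Λ R' δ₃ R₁ R₂ K₃ hΛ hR' hδ₃ hK₃ hR₁ hR₂ hK3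
  have hΛΛ₀ : Λ₀ ≤ Λ := (le_max_left _ _).trans hΛ
  have hΛ400 : (400 : ℝ) ≤ Λ := ((le_max_left _ _).trans (le_max_right _ _)).trans hΛ
  have hΛexp : 8 * (8 * 10 ^ 12 * Γ + L₀ + 1) ≤ Λ :=
    ((le_max_right _ _).trans (le_max_right _ _)).trans hΛ
  have hΛ0 : 0 < Λ := by linarith only [hΛ400]
  -- ### the Carleman time scale `T` and the depth scale `T₁ = T / (8·10¹²)`
  set T : ℝ := min (δ₃ / 4) (min (R' ^ 2) (1 / K₃ ^ 2)) with hTdef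
  have hT0 : 0 < T := lt_min (by positivity) (lt_min (by positivity) (by positivity))
  have hTδ : T ≤ δ₃ / 4 := min_le_left _ _
  have hTR : T ≤ R' ^ 2 := (min_le_right _ _).trans (min_le_left _ _)
  have hTK : T ≤ 1 / K₃ ^ 2 := (min_le_right _ _).trans (min_le_right _ _)
  set T₁ : ℝ := T / (8 * 10 ^ 12) with hT₁def
  have hT₁0 : 0 < T₁ := by positivity
  have hT₁T : T₁ ≤ T := by rw [hT₁def]; exact div_le_self hT0.le (by norm_num)
  have hT₁R : T₁ ≤ R' ^ 2 := hT₁T.trans hTR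
  -- ### the depth shell mass (5.7), uniform in the top time
  obtain ⟨t₁, ht₁, hmass⟩ := hball U P v hsw hD hrate hvU hvc hvs hcl hQ1 R' T₁ hR' hT₁0 hT₁R
  set ζ₀ : ℝ := κ₀ * T₁ ^ (-(1 / 2 : ℝ)) * Real.exp (-(Γ * R' ^ 2 / T₁)) with hζ₀
  have hζ₀0 : 0 < ζ₀ := by positivity
  set ζ : ℝ := (c₂ / 2 * T₁) * ζ₀ with hζ
  have hζ0 : 0 < ζ := by positivity
  set η : ℝ := ζ * T⁻¹ * Real.exp (-(Kt * Λ ^ 2 * R' ^ 2 / T)) with hη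
  have hη0 : 0 < η := by positivity
  refine ⟨η, -(T₁ / 4), hη0, by linarith only [hT₁0], fun b hb => ?_⟩
  have hb0 : b < 0 := hb.2
  have hbT₁ : -(T₁ / 4) < b := hb.1
  -- ### the classical frame `[b - T, b]`
  obtain ⟨q, hclass⟩ := hcl b T hb0 hT0
  -- the smooth structure of `v` below the top time
  have hvsm : ContDiffOn ℝ (⊤ : ℕ∞) (uncurry v) (Iio 0 ×ˢ (univ : Set (EuclideanSpace ℝ (Fin 3)))) :=
    hvs
  have hvslice : ∀ t < 0, ContDiff ℝ (⊤ : ℕ∞) (v t) := fun t ht =>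
    hvs.contDiff_slice (show t ∈ Iio (0 : ℝ) from ht)
  have hDc : ContinuousOn (fun z : ℝ × EuclideanSpace ℝ (Fin 3) => fderiv ℝ (v z.1) z.2)
      (Iio 0 ×ˢ (univ : Set (EuclideanSpace ℝ (Fin 3)))) :=
    continuousOn_fderiv_slice_of_isOpen (isOpen_Iio.prod isOpen_univ) hvsm (by norm_cast)
  have hωc : ContinuousOn (fun z : ℝ × EuclideanSpace ℝ (Fin 3) => vorticity v z.1 z.2)
      (Iio 0 ×ˢ (univ : Set (EuclideanSpace ℝ (Fin 3)))) :=
    (curlCLM.continuous.comp_continuousOn hDc).congr fun z _ => by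
      simp only [comp_apply, vorticity_apply, curl_eq_curlCLM]
  -- ### (5.10) on the annulus `R' ≤ |x| ≤ Λ R'`, from the quiet-shell bounds
  have hsT : 0 < Real.sqrt T := Real.sqrt_pos.2 hT0
  have hK₃0 : 0 < K₃ := by linarith only [hK₃]
  have hK₃T : K₃ ≤ (Real.sqrt T)⁻¹ := by
    rw [le_inv_comm₀ hK₃0 hsT, Real.sqrt_le_left (inv_pos.2 hK₃0).le, inv_pow, ← one_div]
    exact hTK
  have hT1 : T ≤ 1 := by
    refine hTK.trans ?_
    rw [div_le_one (pow_pos hK₃0 2)]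
    exact one_le_pow₀ hK₃
  have hsT1 : Real.sqrt T ≤ 1 := Real.sqrt_le_one.2 hT1
  have hK₃T' : K₃ ≤ T⁻¹ := by
    refine hK₃T.trans ?_
    rw [inv_le_inv₀ hsT hT0]
    calc T = Real.sqrt T * Real.sqrt T := (Real.mul_self_sqrt hT0.le).symm
      _ ≤ Real.sqrt T * 1 := mul_le_mul_of_nonneg_left hsT1 hsT.le
      _ = Real.sqrt T := mul_one _
  have hK₃T'' : K₃ ≤ T⁻¹ * (Real.sqrt T)⁻¹ := by
    have h1 : 1 ≤ (Real.sqrt T)⁻¹ := (one_le_inv₀ hsT).2 hsT1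
    calc K₃ = K₃ * 1 := (mul_one _).symm
      _ ≤ T⁻¹ * (Real.sqrt T)⁻¹ := mul_le_mul hK₃T' h1 zero_le_one (inv_pos.2 hT0).le
  have hframe : Icc (b - T) b ⊆ Ioo (-δ₃) 0 := fun t ht =>
    ⟨by linarith only [ht.1, hTδ, hbT₁, hT₁T, hδ₃], lt_of_le_of_lt ht.2 hb0⟩
  have h510 : ∀ t ∈ Icc (b - T) b, ∀ x : EuclideanSpace ℝ (Fin 3), R' ≤ ‖x‖ → ‖x‖ ≤ Λ * R' →
      ‖v t x‖ ≤ (Real.sqrt T)⁻¹ ∧ ‖fderiv ℝ (v t) x‖ ≤ T⁻¹ ∧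
        ‖vorticity v t x‖ ≤ T⁻¹ ∧ ‖fderiv ℝ (vorticity v t) x‖ ≤ T⁻¹ * (Real.sqrt T)⁻¹ := by
    intro t ht x hx1 hx2
    obtain ⟨h0, h1, h2, h3⟩ :=
      hK3 t (hframe ht) x (by linarith only [hR₁, hx1]) (by linarith only [hx2, hR₂])
    exact ⟨h0.trans hK₃T, h1.trans hK₃T', h2.trans hK₃T', h3.trans hK₃T''⟩
  -- ### (5.7): the depth shell mass in Tao's frame
  have hexp_le : Real.sqrt T * Real.exp (-(Λ * R' ^ 2 / (8 * T))) ≤ ζ := by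
    -- `ζ = γ₀ √T e^{-8·10¹² Γ R'²/T}` and `Λ/8 - 8·10¹² Γ ≥ L₀ + 1`
    set qq : ℝ := R' ^ 2 / T with hqq
    have hq : 1 ≤ qq := by rw [hqq, le_div_iff₀ hT0, one_mul]; exact hTR
    have hq0 : 0 ≤ qq := zero_le_one.trans hq
    have hsT₁ : 0 < Real.sqrt T₁ := Real.sqrt_pos.2 hT₁0
    have hs8 : 0 < Real.sqrt (8 * 10 ^ 12) := Real.sqrt_pos.2 (by norm_num)
    have h1 : T₁ ^ (-(1 / 2 : ℝ)) = (Real.sqrt T₁)⁻¹ := by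
      rw [Real.rpow_neg hT₁0.le, ← Real.sqrt_eq_rpow]
    have h1' : T₁ * (Real.sqrt T₁)⁻¹ = Real.sqrt T₁ := by
      rw [mul_inv_eq_iff_eq_mul₀ hsT₁.ne', Real.mul_self_sqrt hT₁0.le]
    have h2 : Real.sqrt T₁ = Real.sqrt T / Real.sqrt (8 * 10 ^ 12) := by
      rw [hT₁def, Real.sqrt_div' _ (by norm_num)]
    have h3 : Γ * R' ^ 2 / T₁ = 8 * 10 ^ 12 * Γ * qq := by
      rw [hT₁def, hqq]; field_simp
    have hζeq : ζ = γ₀ * Real.sqrt T * Real.exp (-(8 * 10 ^ 12 * Γ * qq)) := by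
      calc ζ = c₂ / 2 * κ₀ * (T₁ * T₁ ^ (-(1 / 2 : ℝ))) * Real.exp (-(Γ * R' ^ 2 / T₁)) := by
            rw [hζ, hζ₀]; ring
        _ = c₂ / 2 * κ₀ * Real.sqrt T₁ * Real.exp (-(8 * 10 ^ 12 * Γ * qq)) := by rw [h1, h1', h3]
        _ = γ₀ * Real.sqrt T * Real.exp (-(8 * 10 ^ 12 * Γ * qq)) := by
            rw [h2, hγ₀]; field_simp
    rw [hζeq]
    have hkey : Real.exp (-(Λ * R' ^ 2 / (8 * T))) ≤ γ₀ * Real.exp (-(8 * 10 ^ 12 * Γ * qq)) := by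
      have e0 : Λ * R' ^ 2 / (8 * T) = Λ / 8 * qq := by rw [hqq]; field_simp
      have hA : (8 * 10 ^ 12 * Γ + L₀ + 1) * qq ≤ Λ / 8 * qq :=
        mul_le_mul_of_nonneg_right (by linarith only [hΛexp]) hq0
      have hB : L₀ ≤ (L₀ + 1) * qq := by
        have h := mul_le_mul_of_nonneg_left hq hL₀0
        have e : (L₀ + 1) * qq = L₀ * qq + qq := by ring
        rw [e]; linarith only [h, hq]
      have h1 : -(Λ * R' ^ 2 / (8 * T)) ≤ -L₀ + -(8 * 10 ^ 12 * Γ * qq) := by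
        rw [e0]
        have e : (8 * 10 ^ 12 * Γ + L₀ + 1) * qq = 8 * 10 ^ 12 * Γ * qq + (L₀ + 1) * qq := by ring
        linarith only [hA, hB, e]
      have h4 : Real.exp (-L₀) ≤ γ₀ := by
        by_cases hγ1 : 1 ≤ γ₀
        · exact (Real.exp_le_one_iff.2 (by linarith only [hL₀0])).trans hγ1
        · push Not at hγ1
          have : -L₀ ≤ Real.log γ₀ := by
            have h := le_max_right 0 (-Real.log γ₀); rw [← hL₀] at h; linarith only [h]
          calc Real.exp (-L₀) ≤ Real.exp (Real.log γ₀) := Real.exp_le_exp.2 this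
            _ = γ₀ := Real.exp_log hγ₀0
      calc Real.exp (-(Λ * R' ^ 2 / (8 * T))) ≤ Real.exp (-L₀ + -(8 * 10 ^ 12 * Γ * qq)) :=
            Real.exp_le_exp.2 h1
        _ = Real.exp (-L₀) * Real.exp (-(8 * 10 ^ 12 * Γ * qq)) := Real.exp_add _ _
        _ ≤ γ₀ * Real.exp (-(8 * 10 ^ 12 * Γ * qq)) :=
            mul_le_mul_of_nonneg_right h4 (Real.exp_pos _).le
    calc Real.sqrt T * Real.exp (-(Λ * R' ^ 2 / (8 * T)))
        ≤ Real.sqrt T * (γ₀ * Real.exp (-(8 * 10 ^ 12 * Γ * qq))) :=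
          mul_le_mul_of_nonneg_left hkey hsT.le
      _ = γ₀ * Real.sqrt T * Real.exp (-(8 * 10 ^ 12 * Γ * qq)) := by ring
  -- the shell enstrophy is continuous in time on `[b - T, b]` and bounded below on `J`
  set Sh : Set (EuclideanSpace ℝ (Fin 3)) :=
    ball (0 : EuclideanSpace ℝ (Fin 3)) (400 * R') \ closedBall 0 (100 * R') with hSh
  have hShm : MeasurableSet Sh := measurableSet_ball.diff measurableSet_closedBall
  have hShball : Sh ⊆ closedBall (0 : EuclideanSpace ℝ (Fin 3)) (400 * R') :=
    fun x hx => ball_subset_closedBall hx.1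
  have hShvol : volume Sh < ⊤ :=
    lt_of_le_of_lt (measure_mono fun x hx => hx.1) measure_ball_lt_top
  have h400 : 400 * R' ≤ Λ * R' := mul_le_mul_of_nonneg_right hΛ400 hR'.le
  have hShsub : ∀ x ∈ Sh, R₁ < ‖x‖ ∧ ‖x‖ < R₂ := by
    intro x hx
    rw [hSh] at hx
    have hx1 : ‖x‖ < 400 * R' := mem_ball_zero_iff.1 hx.1
    have hx2 : 100 * R' < ‖x‖ := by
      have h := hx.2
      rw [mem_closedBall, dist_zero_right, not_le] at h
      exact h
    exact ⟨by linarith only [hx2, hR₁, hR'], by linarith only [hx1, h400, hR₂]⟩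
  -- slices of the vorticity are continuous, hence integrable on the bounded shell
  have hfiSh : ∀ t : ℝ, t < 0 → IntegrableOn (fun x => ‖vorticity v t x‖ ^ 2) Sh volume := by
    intro t htneg
    have hc : Continuous fun x => ‖vorticity v t x‖ ^ 2 := by
      have h1 : Continuous (vorticity v t) := by
        rw [vorticity_apply, curl_eq_curlCLM_comp]
        exact curlCLM.continuous.comp ((hvslice t htneg).continuous_fderiv (by norm_cast))
      exact h1.norm.pow 2
    exact (hc.continuousOn.integrableOn_compact (isCompact_closedBall _ _)).mono_set hShball
  set F : ℝ → ℝ := fun t => ∫ x in Sh, ‖vorticity v t x‖ ^ 2 with hFdef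
  have hFc : ContinuousOn F (Icc (b - T) b) :=
    continuousOn_setIntegral_vorticity_sq
      (hωc.mono (prod_mono (fun t ht => lt_of_le_of_lt ht.2 hb0) subset_rfl)) hShm hShvol.ne
      fun t ht x hx => (hK3 t (hframe ht) x (hShsub x hx).1 (hShsub x hx).2).2.2.1
  have hF0 : ∀ t, 0 ≤ F t := fun t => integral_nonneg fun x => by positivity
  -- `F ≥ ζ₀` on `J = [t₁ - (c₂/2) T₁, t₁]`
  have hJ : ∀ t ∈ Icc (t₁ - c₂ / 2 * T₁) t₁, ζ₀ ≤ F t := by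
    intro t ht
    have htneg : t < 0 := by linarith only [ht.2, ht₁.2, hT₁0]
    have h1 := hmass t ht
    refine h1.trans ?_
    have hsub : ball ((200 * R') • EuclideanSpace.single (0 : Fin 3) (1 : ℝ)) (100 * R') ⊆ Sh := by
      intro y hy
      set x₀ : EuclideanSpace ℝ (Fin 3) := (200 * R') • EuclideanSpace.single (0 : Fin 3) (1 : ℝ)
        with hx₀def
      have he : ‖EuclideanSpace.single (0 : Fin 3) (1 : ℝ)‖ = 1 := by
        rw [← EuclideanSpace.basisFun_apply]
        exact (EuclideanSpace.basisFun (Fin 3) ℝ).orthonormal.1 0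
      have hx₀ : ‖x₀‖ = 200 * R' := by
        rw [hx₀def, norm_smul, he, mul_one, Real.norm_eq_abs, abs_of_pos (by positivity)]
      rw [mem_ball, dist_eq_norm] at hy
      have h4 := norm_sub_norm_le y x₀
      have h5 := norm_sub_norm_le x₀ y
      rw [norm_sub_rev x₀ y] at h5
      rw [hx₀] at h4 h5
      rw [hSh]
      refine ⟨mem_ball_zero_iff.2 (by linarith only [hy, h4, hR']), fun h => ?_⟩
      rw [mem_closedBall, dist_zero_right] at h
      linarith only [hy, h5, h]
    exact setIntegral_mono_set (hfiSh t htneg) (ae_of_all _ fun x => by positivity)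
      hsub.eventuallyLE
  -- integrate over `J ⊆ [b - T/10¹²/4, b]`
  have hcT0 : 0 ≤ c₂ / 2 * T₁ := by positivity
  have hcT : c₂ / 2 * T₁ ≤ T₁ := mul_le_of_le_one_left hT₁0.le (by linarith only [hc₂'])
  have hJsub1 : b - T / 10 ^ 12 / 4 ≤ t₁ - c₂ / 2 * T₁ := by
    have : T / 10 ^ 12 / 4 = 2 * T₁ := by rw [hT₁def]; ring
    rw [this]; linarith only [ht₁.1, hb0, hcT, hT₁0]
  have hJsub2 : t₁ ≤ b := by linarith only [ht₁.2, hbT₁, hT₁0]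
  have hJle : t₁ - c₂ / 2 * T₁ ≤ t₁ := by linarith only [hcT0]
  have hq0 : 0 ≤ T / 10 ^ 12 / 4 := by positivity
  have hqT : T / 10 ^ 12 / 4 ≤ T := by rw [div_div]; exact div_le_self hT0.le (by norm_num)
  have hIcc_sub : Icc (b - T / 10 ^ 12 / 4) b ⊆ Icc (b - T) b :=
    Icc_subset_Icc (by linarith only [hqT]) le_rfl
  have hFi : IntervalIntegrable F volume (b - T / 10 ^ 12 / 4) b :=
    (hFc.mono hIcc_sub).intervalIntegrable_of_Icc (by linarith only [hq0])
  have h57 : ζ ≤ ∫ t in (b - T / 10 ^ 12 / 4)..b, F t := by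
    have h1 : ∫ t in (t₁ - c₂ / 2 * T₁)..t₁, F t ≤ ∫ t in (b - T / 10 ^ 12 / 4)..b, F t :=
      intervalIntegral.integral_mono_interval hJsub1 hJle hJsub2
        (ae_of_all _ fun t => hF0 t) hFi
    have h2 : ζ ≤ ∫ t in (t₁ - c₂ / 2 * T₁)..t₁, F t := by
      have hFiJ : IntervalIntegrable F volume (t₁ - c₂ / 2 * T₁) t₁ :=
        (hFc.mono (Icc_subset_Icc (by linarith only [hJsub1, hqT]) hJsub2)).intervalIntegrable_of_Icc
          hJle
      have h3 := intervalIntegral.integral_mono_on hJle intervalIntegrable_const hFiJ hJ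
      rw [intervalIntegral.integral_const, smul_eq_mul] at h3
      calc ζ = (t₁ - (t₁ - c₂ / 2 * T₁)) * ζ₀ := by rw [hζ]; ring
        _ ≤ _ := h3
    exact h2.trans h1
  -- ### Tao's annulus lower bound at the top time `b`
  exact htao hclass hT0 hΛΛ₀ hR' hTR h510 hexp_le h57

end Summit.NavierStokesRegularity.NavierStokesRegularity.Theorems.TypeITraceScarL3

end
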